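import Summits.AtomisticToContinuum.Crystallization.Theorems.CoarseGrains.Negative.PredicateAPI
import Summits.AtomisticToContinuum.Crystallization.Theorems.FineGrains.Negative.LoadBearing
import Literature.MathematicalPhysics.StatisticalMechanics.LennardJonesClusters

/-!
# Line `Sketch` (crux `FineGrains`, stmt-AtomisticToContinuum-9330): the LineOne glue

Stub `stub_lineOneGlue` of the line skeleton (card tube-energy-gap-pigeonhole) — pure bookkeeping.

LineOne of the skeleton reads `CoarseGrains → FlatComparison → TubeRigidity → FineGrains`:

* `CoarseGrains` (route decl, crux stmt-9331, BY NAME): every large Lennard-Jones ground state has,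
  for every radius `R`, a ball `B_R(c)` two-way `1/40`-matched with an admissible `Inner` hcp datum;
* `FlatComparison` (neighbour stub, appears here UNFOLDED as the second hypothesis): for a
  `δ`-separated ground state `x`, the sub-cluster `y = range x ∩ B_R(c)` is a `C R²`-almost-minimiser
  against injective competitors with at most as many particles in `B_{R-1}(c)`;
* `TubeRigidity` (neighbour stub, UNFOLDED as the third hypothesis): an `η R³`-almost-minimal
  `δ`-separated cluster in `B_R(c)` confined to the `1/40`-tube of an admissible `Inner` datum and
  two-way matched on `B_{R-1}(c)` contains an `ε`-fine `ρ`-ball `B_ρ(c') ⊆ B_{R-1}(c)`.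

The glue (this file): given `(ρ, ε)`, take `δ` from `LennardJonesMinimalDistance_holds`, `(η, R₁)`
from `TubeRigidity`, `C` from `FlatComparison`, a radius `R ≥ max R₁ 1` with `|C|/η ≤ R` (so that
`C R² ≤ η R³`), and `N₀` from `CoarseGrains` at radius `R + 1`.  For a ground state `x` with
`N ≥ N₀` particles and its coarse datum `(c, t, A)`, enumerate `range x ∩ B_R(c)` injectively as `y`
(`exists_enum_inter_closedBall`, via `Finset.orderEmbOfFin`); the matching at radius `R + 1` gives the
pointwise tube for `y` and the two-way matching of `range y` on `B_{R-1}(c)` (a particle matching a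
site within `R - 1` of `c` is within `R - 1 + 1/40 ≤ R` of `c`, hence a particle of `y`);
`FlatComparison` plus `C R² ≤ η R³` gives the almost-minimality; `TubeRigidity` then yields a fine ball
`B_ρ(c')` of `range y` with `dist c' c + ρ ≤ R - 1`, which is a fine ball of `range x` because every
particle of `x` within `ρ` of `c'` is within `R` of `c`.  All `[folklore]`; nothing here closes an item.
-/

noncomputable section

open Literature.MathematicalPhysics.StatisticalMechanics
open Summit.AtomisticToContinuum.Crystallization.Theorems.CoarseGrains.Negative.PredicateAPI
open Summit.AtomisticToContinuum.Crystallization.Theorems.FineGrains.Negative.LoadBearing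
open Summit.AtomisticToContinuum.Crystallization.Theses

namespace Summit.AtomisticToContinuum.Crystallization.Theorems.ExcessDecayLiouvilleFineGrains

/-- Restriction of an injective configuration to a closed ball: `range x ∩ B_R(c)` has an injective
enumeration `y : Fin n → ℝ³` (order-embedding of the filtered index set, `Finset.orderEmbOfFin`).
[folklore] -/
theorem exists_enum_inter_closedBall {N : ℕ} {x : Fin N → E3} (hx : Function.Injective x) (c : E3)
    (R : ℝ) :
    ∃ (n : ℕ) (y : Fin n → E3), Function.Injective y ∧
      ∀ p : E3, p ∈ Set.range y ↔ p ∈ Set.range x ∧ dist p c ≤ R := by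
  classical
  set S : Finset (Fin N) := Finset.univ.filter fun j => dist (x j) c ≤ R with hS
  refine ⟨S.card, fun k => x (S.orderEmbOfFin rfl k), hx.comp (S.orderEmbOfFin rfl).injective,
    fun p => ⟨?_, ?_⟩⟩
  · rintro ⟨k, rfl⟩
    have hk : S.orderEmbOfFin rfl k ∈ S := Finset.orderEmbOfFin_mem S rfl k
    exact ⟨⟨_, rfl⟩, (Finset.mem_filter.1 hk).2⟩
  · rintro ⟨⟨j, rfl⟩, hj⟩
    have hjS : j ∈ (S : Set (Fin N)) := by
      rw [Finset.mem_coe, hS, Finset.mem_filter]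
      exact ⟨Finset.mem_univ _, hj⟩
    rw [← Finset.range_orderEmbOfFin S rfl] at hjS
    obtain ⟨k, hk⟩ := hjS
    exact ⟨k, congrArg x hk⟩

/-- **LineOne glue** (stub `stub_lineOneGlue` of line `Sketch`, crux `FineGrains`
stmt-AtomisticToContinuum-9330; bookkeeping).  From `CoarseGrains` (route decl BY NAME), the unfolded
statement of `FlatComparison` (hereditary `C R²`-slack of ground-state balls) and the unfolded
statement of `TubeRigidity` (an `η R³`-almost-minimal separated cluster in the `1/40`-tube of an
admissible `Inner` datum contains an `ε`-fine `ρ`-ball inside `B_{R-1}(c)`), every large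
Lennard-Jones ground state has an `ε`-fine `ρ`-ball: `δ` from `LennardJonesMinimalDistance_holds`,
`R ≥ max R₁ 1` with `|C|/η ≤ R` (so `C R² ≤ η R³`), `N₀` from `CoarseGrains` at radius `R + 1`,
`y` = the enumeration of `range x ∩ B_R(c)`; the fine ball of `y` is a fine ball of `x` because
`dist c' c + ρ ≤ R - 1`. [folklore] -/
theorem stub_lineOneGlue :
    ExcessDecayLiouville.CoarseGrains →
    (∀ δ : ℝ, 0 < δ → ∃ C : ℝ, ∀ (N : ℕ) (x : Fin N → E3), IsGroundState lennardJones x →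
      (∀ i j : Fin N, i ≠ j → δ ≤ dist (x i) (x j)) →
      ∀ (c : E3) (R : ℝ), 1 ≤ R → ∀ (n : ℕ) (y : Fin n → E3), Function.Injective y →
        (∀ p : E3, p ∈ Set.range y ↔ p ∈ Set.range x ∧ dist p c ≤ R) →
        ∀ (n' : ℕ) (y' : Fin n' → E3), n' ≤ n → Function.Injective y' →
          (∀ i : Fin n', dist (y' i) c ≤ R - 1) →
          interactionEnergy lennardJones y ≤ interactionEnergy lennardJones y' + C * R ^ 2) →
    (∀ ρ ε δ : ℝ, 0 < ρ → 0 < ε → 0 < δ → ∃ η : ℝ, 0 < η ∧ ∃ R₁ : ℝ, ∀ R : ℝ, R₁ ≤ R →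
      ∀ (c : E3) (t : Fin 2 → E3) (A : E3 →L[ℝ] E3), Adm A → Inner t A →
      ∀ (n : ℕ) (y : Fin n → E3), Function.Injective y →
        (∀ i j : Fin n, i ≠ j → δ ≤ dist (y i) (y j)) →
        (∀ i : Fin n, dist (y i) c ≤ R) →
        (∀ i : Fin n, ∃ m : Fin 2, ∃ z ∈ Lam, dist (y i) (t m + A z) ≤ 1 / 40) →
        Near (Set.range y) c (R - 1) t A (1 / 40) →
        (∀ (n' : ℕ) (y' : Fin n' → E3), n' ≤ n → Function.Injective y' →
          (∀ i : Fin n', dist (y' i) c ≤ R - 1) →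
          interactionEnergy lennardJones y ≤ interactionEnergy lennardJones y' + η * R ^ 3) →
        ∃ (c' : E3) (t' : Fin 2 → E3) (A' : E3 →L[ℝ] E3),
          Adm A' ∧ dist c' c + ρ ≤ R - 1 ∧ Near (Set.range y) c' ρ t' A' ε) →
    ∀ ρ ε : ℝ, 0 < ρ → 0 < ε → ∃ N₀ : ℕ, ∀ N : ℕ, N₀ ≤ N → ∀ x : Fin N → E3,
      IsGroundState lennardJones x → HasFineBall ρ ε x := by
  intro hCG hFlat hTube ρ ε hρ hε
  -- the constants: δ (minimal distance), (η, R₁) (tube rigidity), C (flat comparison), R, N₀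
  obtain ⟨δ, hδ, hsep⟩ := LennardJonesMinimalDistance_holds
  obtain ⟨η, hη, R₁, hT⟩ := hTube ρ ε δ hρ hε hδ
  obtain ⟨C, hC⟩ := hFlat δ hδ
  obtain ⟨R, hR₁, h1R, hCη⟩ : ∃ R : ℝ, R₁ ≤ R ∧ 1 ≤ R ∧ |C| / η ≤ R :=
    ⟨max (max R₁ 1) (|C| / η), le_trans (le_max_left _ _) (le_max_left _ _),
      le_trans (le_max_right _ _) (le_max_left _ _), le_max_right _ _⟩
  have hCR : C * R ^ 2 ≤ η * R ^ 3 := by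
    have h1 : |C| ≤ η * R := by
      have h := (div_le_iff₀ hη).1 hCη
      linarith
    have hR2 : 0 ≤ R ^ 2 := sq_nonneg R
    calc C * R ^ 2 ≤ |C| * R ^ 2 := mul_le_mul_of_nonneg_right (le_abs_self C) hR2
      _ ≤ (η * R) * R ^ 2 := mul_le_mul_of_nonneg_right h1 hR2
      _ = η * R ^ 3 := by ring
  obtain ⟨N₀, hN₀⟩ := (coarseGrains_iff.1 hCG) (R + 1) (by linarith)
  refine ⟨N₀, fun N hN x hx => ?_⟩
  -- the coarse datum of `x` at radius `R + 1` and the sub-cluster `y = range x ∩ B_R(c)`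
  obtain ⟨c, t, A, hA, hI, hNear⟩ := hN₀ N hN x hx
  obtain ⟨n, y, hyinj, hrange⟩ := exists_enum_inter_closedBall hx.1 c R
  have hyi : ∀ i : Fin n, y i ∈ Set.range x ∧ dist (y i) c ≤ R :=
    fun i => (hrange (y i)).1 ⟨i, rfl⟩
  -- the hypotheses of `TubeRigidity` for `y`
  have hysep : ∀ i j : Fin n, i ≠ j → δ ≤ dist (y i) (y j) := by
    intro i j hij
    obtain ⟨⟨i', hi'⟩, -⟩ := hyi i
    obtain ⟨⟨j', hj'⟩, -⟩ := hyi j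
    have hij' : i' ≠ j' := by
      intro h
      apply hij
      apply hyinj
      rw [← hi', ← hj', h]
    rw [← hi', ← hj']
    exact hsep N x hx i' j' hij'
  have hyball : ∀ i : Fin n, dist (y i) c ≤ R := fun i => (hyi i).2
  have hytube : ∀ i : Fin n, ∃ m : Fin 2, ∃ z ∈ Lam, dist (y i) (t m + A z) ≤ 1 / 40 := by
    intro i
    obtain ⟨hmem, hd⟩ := hyi i
    exact hNear.1 (y i) hmem (by linarith)
  have hyNear : Near (Set.range y) c (R - 1) t A (1 / 40) := by
    refine ⟨fun p hp hpc => ?_, fun m z hz hzc => ?_⟩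
    · obtain ⟨hpx, -⟩ := (hrange p).1 hp
      exact hNear.1 p hpx (by linarith)
    · obtain ⟨p, hpx, hpz⟩ := hNear.2 m z hz (by linarith)
      refine ⟨p, (hrange p).2 ⟨hpx, ?_⟩, hpz⟩
      calc dist p c ≤ dist p (t m + A z) + dist (t m + A z) c := dist_triangle _ _ _
        _ ≤ 1 / 40 + (R - 1) := add_le_add hpz hzc
        _ ≤ R := by linarith
  have hymin : ∀ (n' : ℕ) (y' : Fin n' → E3), n' ≤ n → Function.Injective y' →
      (∀ i : Fin n', dist (y' i) c ≤ R - 1) →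
      interactionEnergy lennardJones y ≤ interactionEnergy lennardJones y' + η * R ^ 3 := by
    intro n' y' hn' hy' hy'c
    have h := hC N x hx (hsep N x hx) c R h1R n y hyinj hrange n' y' hn' hy' hy'c
    linarith
  -- the fine ball of `y` inside `B_{R-1}(c)` is a fine ball of `x`
  obtain ⟨c', t', A', hA', hcc', hN'⟩ :=
    hT R hR₁ c t A hA hI n y hyinj hysep hyball hytube hyNear hymin
  refine ⟨c', t', A', hA', fun p hp hpc => ?_, fun m z hz hzc => ?_⟩
  · have hpc' : dist p c ≤ R :=
      calc dist p c ≤ dist p c' + dist c' c := dist_triangle _ _ _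
        _ ≤ ρ + dist c' c := add_le_add hpc le_rfl
        _ ≤ R := by linarith
    exact hN'.1 p ((hrange p).2 ⟨hp, hpc'⟩) hpc
  · obtain ⟨p, hpy, hpz⟩ := hN'.2 m z hz hzc
    exact ⟨p, ((hrange p).1 hpy).1, hpz⟩

end Summit.AtomisticToContinuum.Crystallization.Theorems.ExcessDecayLiouvilleFineGrains

end
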